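import Summits.CriticalPhenomena.CardyFormulaZ2.Theorems.CardyBoundaryCoulombGasHalfPlaneMarkDensityLawShortArcFar

/-!
# Line `Sketch`, self-duality programme, Stage II: the right end-zone estimate `endZoneR_small`
# (crux stmt-CriticalPhenomena-5661, lead c3-0)

For the right boundary arc `[0, S] × {0}`, `S = ⌊σn⌋`, of the lattice half-plane `H = ℤ × ℕ` of
bond-`ℤ²` at `p = 1/2`, the two END-ZONE events of the thinning inequality — the short boundary arcs
`[0, ⌊δn⌋] × {0}` and `[S − ⌊δn⌋, S] × {0}` are joined inside `H` to the far ray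
`I_n = (−∞, −⌊xn⌋] × {0}` — have probability `≤ ε` once `δ ≤ δ₀(σ, x, ε)` and `n` is large:
a direct application of the one-arm end-zone bound `shortArc_far` with `ℓ = ⌊δn⌋`,
`ℓ + D = ⌊xn⌋ − 1`, whose right-hand side `C ((⌊δn⌋+1)/(⌊xn⌋−1))^α ≤ C (4δ/x)^α ≤ ε`.
-/

noncomputable section

namespace Summit.CriticalPhenomena.CardyFormulaZ2.Cruxes.HalfPlaneMarkDensityLaw.SketchLine.SelfDual

open Literature.Probability.Percolation Literature.Probability.LatticeModels
open MeasureTheory Filter Set SimpleGraph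
open Summit.CriticalPhenomena.CardyFormulaZ2.Theorems.HalfPlaneMarkDensityLaw.Negative

/-- **Right end zones are small.** For `σ, x, ε > 0` there is `δ₀ > 0` such that for every
`0 < δ ≤ δ₀`, for all large `n`, both short boundary arcs `[0, ⌊δn⌋] × {0}` and
`[⌊σn⌋ − ⌊δn⌋, ⌊σn⌋] × {0}` are joined inside the lattice half-plane to the far ray
`(−∞, −⌊xn⌋] × {0}` with `P_{1/2}`-probability at most `ε`: by the one-arm end-zone bound
`shortArc_far` with `ℓ = ⌊δn⌋`, `ℓ + D = ⌊xn⌋ − 1`, and `C ((⌊δn⌋+1)/(⌊xn⌋−1))^α ≤ C (4δ/x)^α ≤ ε`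
for `δ ≤ (x/4) (ε/C)^{1/α}`. [folklore] -/
theorem endZoneR_small : ∀ {σ x : ℝ}, 0 < σ → 0 < x → ∀ {ε : ℝ}, 0 < ε → ∃ δ₀ : ℝ, 0 < δ₀ ∧ ∀ δ : ℝ, 0 < δ → δ ≤ δ₀ → ∀ᶠ n : ℕ in atTop, μ.real (openCrossing halfPlane (rowIcc 0 ⌊δ * n⌋) {v : Site 2 | v 1 = 0 ∧ v 0 ≤ -⌊x * n⌋}) ≤ ε ∧ μ.real (openCrossing halfPlane (rowIcc (⌊σ * n⌋ - ⌊δ * n⌋) ⌊σ * n⌋) {v : Site 2 | v 1 = 0 ∧ v 0 ≤ -⌊x * n⌋}) ≤ ε := by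
  intro σ x hσ hx ε hε
  obtain ⟨C, α, hC, hα, h⟩ := shortArc_far
  -- the threshold `η = (ε/C)^{1/α}` for `4δ/x`
  obtain ⟨η, hη0, hηα⟩ : ∃ η : ℝ, 0 < η ∧ η ^ α = ε / C :=
    ⟨(ε / C) ^ α⁻¹, Real.rpow_pos_of_pos (div_pos hε hC) _,
      Real.rpow_inv_rpow (div_pos hε hC).le hα.ne'⟩
  refine ⟨min σ (min (x / 4) (x / 4 * η)), lt_min hσ (lt_min (by positivity) (by positivity)),
    fun δ hδ hδle => ?_⟩
  obtain ⟨hδσ, hδx, hδη⟩ : δ ≤ σ ∧ δ ≤ x / 4 ∧ δ ≤ x / 4 * η := by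
    simpa only [le_min_iff] using hδle
  -- the key real estimate `C (4δ/x)^α ≤ ε`
  have hkey : C * (4 * δ / x) ^ α ≤ ε := by
    have h1 : 4 * δ / x ≤ η := by
      rw [div_le_iff₀ hx]; linarith
    have h2 : (4 * δ / x) ^ α ≤ η ^ α := Real.rpow_le_rpow (by positivity) h1 hα.le
    calc C * (4 * δ / x) ^ α ≤ C * η ^ α := mul_le_mul_of_nonneg_left h2 hC.le
      _ = ε := by rw [hηα]; field_simp
  have hev1 : ∀ᶠ n : ℕ in atTop, 1 ≤ δ * (n : ℝ) :=
    (Tendsto.const_mul_atTop hδ tendsto_natCast_atTop_atTop).eventually_ge_atTop 1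
  have hev2 : ∀ᶠ n : ℕ in atTop, 4 ≤ x * (n : ℝ) :=
    (Tendsto.const_mul_atTop hx tendsto_natCast_atTop_atTop).eventually_ge_atTop 4
  filter_upwards [eventually_gt_atTop 0, hev1, hev2] with n hn hn1 hn2
  have hn0 : (0 : ℝ) < n := Nat.cast_pos.mpr hn
  -- elementary facts about the three floors
  have hℓ0 : (0 : ℤ) ≤ ⌊δ * (n : ℝ)⌋ := Int.floor_nonneg.mpr (by positivity)
  have hℓle : ((⌊δ * (n : ℝ)⌋ : ℤ) : ℝ) ≤ δ * n := Int.floor_le _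
  have hXgt : x * n - 1 < ((⌊x * (n : ℝ)⌋ : ℤ) : ℝ) := Int.sub_one_lt_floor _
  have hδxn : δ * n ≤ x / 4 * n := mul_le_mul_of_nonneg_right hδx (Nat.cast_nonneg n)
  have hXℓ : ⌊δ * (n : ℝ)⌋ + 2 ≤ ⌊x * (n : ℝ)⌋ := by
    have h1 : ((⌊δ * (n : ℝ)⌋ : ℤ) : ℝ) + 1 < ((⌊x * (n : ℝ)⌋ : ℤ) : ℝ) := by linarith
    have h2 : ⌊δ * (n : ℝ)⌋ + 1 < ⌊x * (n : ℝ)⌋ := by exact_mod_cast h1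
    omega
  have hℓS : ⌊δ * (n : ℝ)⌋ ≤ ⌊σ * (n : ℝ)⌋ :=
    Int.floor_le_floor (mul_le_mul_of_nonneg_right hδσ (Nat.cast_nonneg n))
  -- the parameters `ℓ = ⌊δn⌋`, `D = ⌊xn⌋ - ⌊δn⌋ - 1` of `shortArc_far`
  have hℓcast : ((⌊δ * (n : ℝ)⌋.toNat : ℕ) : ℤ) = ⌊δ * (n : ℝ)⌋ := Int.toNat_of_nonneg hℓ0
  have hDcast : (((⌊x * (n : ℝ)⌋ - ⌊δ * (n : ℝ)⌋ - 1).toNat : ℕ) : ℤ) =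
      ⌊x * (n : ℝ)⌋ - ⌊δ * (n : ℝ)⌋ - 1 := Int.toNat_of_nonneg (by omega)
  have hD1 : 1 ≤ (⌊x * (n : ℝ)⌋ - ⌊δ * (n : ℝ)⌋ - 1).toNat := by
    have h1 : (1 : ℤ) ≤ (((⌊x * (n : ℝ)⌋ - ⌊δ * (n : ℝ)⌋ - 1).toNat : ℕ) : ℤ) := by
      rw [hDcast]; omega
    exact_mod_cast h1
  -- the far ray is far from both short arcs
  have hfar1 : ∀ f ∈ {v : Site 2 | v 1 = 0 ∧ v 0 ≤ -⌊x * (n : ℝ)⌋},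
      ((⌊δ * (n : ℝ)⌋.toNat : ℕ) : ℤ) + ((⌊x * (n : ℝ)⌋ - ⌊δ * (n : ℝ)⌋ - 1).toNat : ℕ) <
        |f 0 - 0| ∨
      ((⌊δ * (n : ℝ)⌋.toNat : ℕ) : ℤ) + ((⌊x * (n : ℝ)⌋ - ⌊δ * (n : ℝ)⌋ - 1).toNat : ℕ) <
        |f 1| := by
    rintro f ⟨-, hf⟩
    left
    rw [hℓcast, hDcast, sub_zero]
    exact lt_abs.mpr (Or.inr (by omega))
  have hfar2 : ∀ f ∈ {v : Site 2 | v 1 = 0 ∧ v 0 ≤ -⌊x * (n : ℝ)⌋},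
      ((⌊δ * (n : ℝ)⌋.toNat : ℕ) : ℤ) + ((⌊x * (n : ℝ)⌋ - ⌊δ * (n : ℝ)⌋ - 1).toNat : ℕ) <
        |f 0 - (⌊σ * (n : ℝ)⌋ - ⌊δ * (n : ℝ)⌋)| ∨
      ((⌊δ * (n : ℝ)⌋.toNat : ℕ) : ℤ) + ((⌊x * (n : ℝ)⌋ - ⌊δ * (n : ℝ)⌋ - 1).toNat : ℕ) <
        |f 1| := by
    rintro f ⟨-, hf⟩
    left
    rw [hℓcast, hDcast]
    exact lt_abs.mpr (Or.inr (by omega))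
  have hb1 := h 0 _ _ _ hfar1 hD1
  have hb2 := h _ _ _ _ hfar2 hD1
  rw [zero_add, hℓcast] at hb1
  rw [hℓcast, sub_add_cancel] at hb2
  -- the common right-hand side is `≤ C (4δ/x)^α ≤ ε`
  have hB : C * ((((⌊δ * (n : ℝ)⌋.toNat : ℕ) : ℝ) + 1) /
      (((⌊δ * (n : ℝ)⌋.toNat : ℕ) : ℝ) + (((⌊x * (n : ℝ)⌋ - ⌊δ * (n : ℝ)⌋ - 1).toNat : ℕ) : ℝ))) ^ α
        ≤ ε := by
    have hℓR : ((⌊δ * (n : ℝ)⌋.toNat : ℕ) : ℝ) = ((⌊δ * (n : ℝ)⌋ : ℤ) : ℝ) := by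
      exact_mod_cast hℓcast
    have hDR : (((⌊x * (n : ℝ)⌋ - ⌊δ * (n : ℝ)⌋ - 1).toNat : ℕ) : ℝ) =
        ((⌊x * (n : ℝ)⌋ : ℤ) : ℝ) - ((⌊δ * (n : ℝ)⌋ : ℤ) : ℝ) - 1 := by
      exact_mod_cast hDcast
    rw [hℓR, hDR, show ((⌊δ * (n : ℝ)⌋ : ℤ) : ℝ) + (((⌊x * (n : ℝ)⌋ : ℤ) : ℝ) -
      ((⌊δ * (n : ℝ)⌋ : ℤ) : ℝ) - 1) = ((⌊x * (n : ℝ)⌋ : ℤ) : ℝ) - 1 by ring]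
    have hratio : (((⌊δ * (n : ℝ)⌋ : ℤ) : ℝ) + 1) / (((⌊x * (n : ℝ)⌋ : ℤ) : ℝ) - 1) ≤ 4 * δ / x :=
      calc (((⌊δ * (n : ℝ)⌋ : ℤ) : ℝ) + 1) / (((⌊x * (n : ℝ)⌋ : ℤ) : ℝ) - 1)
            ≤ 2 * (δ * n) / (x * n / 2) :=
              div_le_div₀ (by positivity) (by linarith) (by linarith) (by linarith)
        _ = 4 * δ / x := by
              rw [div_eq_div_iff (by positivity) hx.ne']; ring
    have hbase : 0 ≤ (((⌊δ * (n : ℝ)⌋ : ℤ) : ℝ) + 1) / (((⌊x * (n : ℝ)⌋ : ℤ) : ℝ) - 1) :=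
      div_nonneg (by positivity) (by linarith)
    calc C * ((((⌊δ * (n : ℝ)⌋ : ℤ) : ℝ) + 1) / (((⌊x * (n : ℝ)⌋ : ℤ) : ℝ) - 1)) ^ α
          ≤ C * (4 * δ / x) ^ α :=
            mul_le_mul_of_nonneg_left (Real.rpow_le_rpow hbase hratio hα.le) hC.le
      _ ≤ ε := hkey
  exact ⟨hb1.trans hB, hb2.trans hB⟩

end Summit.CriticalPhenomena.CardyFormulaZ2.Cruxes.HalfPlaneMarkDensityLaw.SketchLine.SelfDual
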